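import Summits.CriticalPhenomena.PercolationContinuityZ3.Theorems.PercNearOneGluingNoHeavyLowerTailKnQuestion8CoefficientwiseReach
import Summits.CriticalPhenomena.PercolationContinuityZ3.Theorems.PercNearOneGluingNoHeavyLowerTailKnQuestion8CoefficientwisePointLocality
import HarnessLib

/-!
# The REACH reduction, sharp form: only gadget instances whose free edges avoid `z` are needed

Support file (`--supports stmt-CriticalPhenomena-4575`, closed), prover `prim-lf-2` (gen 40).  No definitions, no named facts, no sorries;
standard axioms.  Memo `prim-lf-2/CW-GINIBRE-gen40.md` §3.

`…CoefficientwiseReach.lean` proved: if the gadget REACH sums `Σ_{ω ⊆ E} 1{z ∈ C(ω ∪ Γ)} Δf Δg` are `≥ 0` for ALL disjoint `(E, Γ)`, then the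
decided-weight inequality `Σ_{s : z ∈ C(s), z ∉ C(sᶜ)} Δf Δg ≥ 0` (`T''(z) ≥ 0` of CW-PROGRAMME-gen21) follows, by cells of the blue cluster of `z`.
The same generation then REFUTED the unrestricted hypothesis (8 vertices, `Γ = ∅`, points `f = 1_u`, `g = 1_w`:
`x=0`, edges `0-4, 0-4, 5-7, 3-2, 4-6, 3-4, 0-3, 0-7, 5-6, 1-6, 0-2, 0-5`, `z = 6, u = 2, w = 7`: `Σ_{z ∈ C(s)} σ_u σ_w = −2`; the doubly-reached
colourings of `z` contribute `−24`).  The cell decomposition, however, only ever uses instances whose free edges lie off the blue cluster of `z`,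
in particular avoid `z`; there `z` is never blue-reached and the hypothesis is the gadget form of the decided inequality itself.  This file
records the reduction with that sharp hypothesis (`decided_twoColouring_nonneg_of_reach_isolated`); no counterexample to the sharp hypothesis is
known (every one of the 1 492 338 cells at `n ≤ 6` is `≥ 0`; annealed hill-climbs at `n = 8, 9` find none), so 'cellwise positivity of T''`
remains a live route.  Proof: verbatim the cell argument, plus the remark that an edge off `I(S)` cannot contain `z ∈ S`.
[cite: KozmaNitzan2024, Questions 8–9 (§5.5 p. 36) (context: the Question-8 pocket covariance programme)]
-/

namespace Summit.CriticalPhenomena.PercolationContinuityZ3.Theorems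

open Finset Literature.Probability.Percolation

namespace Coefficientwise

variable {ι V : Type*} [Fintype ι] [DecidableEq ι]

open Classical in
/-- **The REACH reduction, sharp form** (prim-lf-2 gen 40, append).  Same conclusion as `decided_twoColouring_nonneg_of_reach`, but the hypothesis is
only required for the gadget instances `(E, Γ)` whose FREE edges avoid `z` (`∀ i ∈ E, z ∉ ends i`) — exactly the instances the cell decomposition
produces (the free edges lie off the blue cluster of `z`, which contains `z`).  In such an instance `z` is never in the blue cluster `C(E ∖ ω)`, so
the hypothesis is the gadget form of the DECIDED inequality itself ('REACH_cell'); the unrestricted gadget REACH principle is FALSE in general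
(prim-lf-2 gen 40, 8-vertex witness with `Γ = ∅`: `Σ_{z ∈ C(s)} σ_u σ_w = −2`), while no counterexample to the restricted form is known
(hill-climbs `n ≤ 9`, all 1 492 338 cells at `n ≤ 6` non-negative).
[cite: KozmaNitzan2024, Questions 8–9 (§5.5 p. 36) (context)] -/
theorem decided_twoColouring_nonneg_of_reach_isolated (ends : ι → Sym2 V) (x z : V) (f g : Set V → ℝ)
    (hreach : ∀ E Γ : Finset ι, Disjoint E Γ → (∀ i ∈ E, z ∉ ends i) →
      0 ≤ ∑ ω ∈ E.powerset, if z ∈ openCluster (ends '' (↑(ω ∪ Γ) : Set ι)) x then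
        (f (openCluster (ends '' (↑(ω ∪ Γ) : Set ι)) x) - f (openCluster (ends '' (↑(E \ ω) : Set ι)) x)) *
          (g (openCluster (ends '' (↑(ω ∪ Γ) : Set ι)) x) - g (openCluster (ends '' (↑(E \ ω) : Set ι)) x)) else 0) :
    0 ≤ ∑ s ∈ univ.filter (fun s : Finset ι =>
        z ∈ openCluster (ends '' (↑s : Set ι)) x ∧ z ∉ openCluster (ends '' (↑(sᶜ) : Set ι)) x),
      (f (openCluster (ends '' (↑s : Set ι)) x) - f (openCluster (ends '' (↑(sᶜ) : Set ι)) x)) *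
        (g (openCluster (ends '' (↑s : Set ι)) x) - g (openCluster (ends '' (↑(sᶜ) : Set ι)) x)) := by
  -- notation
  set K : Finset ι → Set V := fun s => openCluster (ends '' (↑s : Set ι)) x with hK
  set Φ : Finset ι → ℝ := fun s => (f (K s) - f (K sᶜ)) * (g (K s) - g (K sᶜ)) with hΦ
  -- rewrite the restricted sum as a weighted sum over the event `{z ∉ C(sᶜ)}`
  set D : Finset (Finset ι) := univ.filter (fun s : Finset ι => z ∉ openCluster (ends '' (↑(sᶜ) : Set ι)) x) with hD
  have hsplit : ∑ s ∈ univ.filter (fun s : Finset ι =>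
        z ∈ openCluster (ends '' (↑s : Set ι)) x ∧ z ∉ openCluster (ends '' (↑(sᶜ) : Set ι)) x), Φ s =
      ∑ s ∈ D, if z ∈ K s then Φ s else 0 := by
    rw [Finset.sum_ite, Finset.sum_const_zero, add_zero]
    refine Finset.sum_congr ?_ fun _ _ => rfl
    ext s
    simp only [hD, Finset.mem_filter, Finset.mem_univ, true_and, hK]
    tauto
  change 0 ≤ ∑ s ∈ univ.filter (fun s : Finset ι =>
        z ∈ openCluster (ends '' (↑s : Set ι)) x ∧ z ∉ openCluster (ends '' (↑(sᶜ) : Set ι)) x), Φ s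
  rw [hsplit]
  -- the blue cluster of `z`, the edges at a vertex set, and the cell key
  set Bl : Finset ι → Set V := fun s => openCluster (ends '' (↑(sᶜ) : Set ι)) z with hBl
  set I : Set V → Finset ι := fun S => univ.filter (fun i : ι => ∃ v ∈ S, v ∈ ends i) with hI
  set key : Finset ι → Set V × Finset ι := fun s => (Bl s, s ∩ I (Bl s)) with hkey
  have Bl_closed : ∀ (s : Finset ι) {u w : V}, u ∈ Bl s → (openGraph (ends '' (↑(sᶜ) : Set ι))).Adj u w → w ∈ Bl s :=
    fun s u w hu hadj => SimpleGraph.Reachable.trans hu hadj.reachable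
  have mem_I : ∀ (S : Set V) (i : ι) (v : V), v ∈ S → v ∈ ends i → i ∈ I S := by
    intro S i v hv hvi
    simp only [hI, Finset.mem_filter, Finset.mem_univ, true_and]
    exact ⟨v, hv, hvi⟩
  have z_mem_Bl : ∀ s : Finset ι, z ∈ Bl s := fun s => mem_openCluster_self _ z
  -- (L1) locality: agreeing with `s₀` on the edges at `Bl s₀` forces the same blue cluster of `z`
  have locality : ∀ s₀ t : Finset ι, t ∩ I (Bl s₀) = s₀ ∩ I (Bl s₀) → Bl t = Bl s₀ := by
    intro s₀ t ht
    have agree : ∀ i, i ∈ I (Bl s₀) → (i ∈ t ↔ i ∈ s₀) := by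
      intro i hi
      have := congrArg (fun u : Finset ι => i ∈ u) ht
      simp only [Finset.mem_inter, hi, and_true, eq_iff_iff] at this
      exact this
    have agreec : ∀ i, i ∈ I (Bl s₀) → (i ∈ tᶜ ↔ i ∈ s₀ᶜ) := fun i hi => by
      rw [Finset.mem_compl, Finset.mem_compl, agree i hi]
    have h1 : ∀ u ∈ Bl s₀, ∀ w, (openGraph (ends '' (↑(s₀ᶜ) : Set ι))).Adj u w →
        (openGraph (ends '' (↑(tᶜ) : Set ι))).Adj u w ∧ w ∈ Bl s₀ := by
      intro u hu w hadj
      refine ⟨?_, Bl_closed s₀ hu hadj⟩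
      rw [openGraph_image_adj] at hadj ⊢
      obtain ⟨⟨i, his, hi⟩, hne⟩ := hadj
      have hiI : i ∈ I (Bl s₀) := mem_I _ i u hu (by rw [hi]; exact Sym2.mem_mk_left u w)
      exact ⟨⟨i, (agreec i hiI).mpr his, hi⟩, hne⟩
    have h2 : ∀ u ∈ Bl s₀, ∀ w, (openGraph (ends '' (↑(tᶜ) : Set ι))).Adj u w →
        (openGraph (ends '' (↑(s₀ᶜ) : Set ι))).Adj u w ∧ w ∈ Bl s₀ := by
      intro u hu w hadj
      have hadj' : (openGraph (ends '' (↑(s₀ᶜ) : Set ι))).Adj u w := by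
        rw [openGraph_image_adj] at hadj ⊢
        obtain ⟨⟨i, hit, hi⟩, hne⟩ := hadj
        have hiI : i ∈ I (Bl s₀) := mem_I _ i u hu (by rw [hi]; exact Sym2.mem_mk_left u w)
        exact ⟨⟨i, (agreec i hiI).mp hit, hi⟩, hne⟩
      exact ⟨hadj', Bl_closed s₀ hu hadj'⟩
    ext y
    constructor
    · intro hy
      obtain ⟨p⟩ := hy
      exact ((reachable_transfer (Bl s₀) h2 p) (z_mem_Bl s₀)).2
    · intro hy
      obtain ⟨p⟩ := hy
      exact ((reachable_transfer (Bl s₀) h1 p) (z_mem_Bl s₀)).1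
  -- split the sum over `D` along the fibres of `key`
  rw [← Finset.sum_fiberwise_of_maps_to (s := D) (t := D.image key) (g := key)
    (fun s hs => Finset.mem_image_of_mem key hs)]
  refine Finset.sum_nonneg fun k hk => ?_
  obtain ⟨s₀, hs₀D, rfl⟩ := Finset.mem_image.mp hk
  have hs₀ : z ∉ K s₀ᶜ := by
    have := (Finset.mem_filter.mp hs₀D).2
    simpa [hK] using this
  -- frozen data of the cell of `s₀`
  set S₀ : Set V := Bl s₀ with hS₀
  set B : Finset ι := I S₀ with hB
  set π : Finset ι := s₀ ∩ B with hπ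
  have hxS₀ : x ∉ S₀ := fun hx => hs₀ (SimpleGraph.Reachable.symm hx)
  have hπB : π ⊆ B := Finset.inter_subset_right
  -- (L2) the fibre of `key s₀` in `D` is exactly the cell `{t | t ∩ B = π}`
  have fiber_eq : D.filter (fun t => key t = key s₀) = univ.filter (fun t : Finset ι => t ∩ B = π) := by
    ext t
    simp only [Finset.mem_filter, Finset.mem_univ, true_and]
    constructor
    · rintro ⟨_, hkt⟩
      have h1 : Bl t = S₀ := (Prod.ext_iff.mp hkt).1
      have h2 : t ∩ I (Bl t) = s₀ ∩ I (Bl s₀) := (Prod.ext_iff.mp hkt).2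
      rw [h1] at h2
      exact h2
    · intro ht
      have hBt : Bl t = S₀ := locality s₀ t ht
      refine ⟨?_, ?_⟩
      · rw [hD, Finset.mem_filter]
        refine ⟨Finset.mem_univ _, fun hzt => ?_⟩
        have hxBt : x ∈ Bl t := SimpleGraph.Reachable.symm hzt
        rw [hBt] at hxBt
        exact hxS₀ hxBt
      · change (Bl t, t ∩ I (Bl t)) = (Bl s₀, s₀ ∩ I (Bl s₀))
        rw [hBt]
        exact Prod.ext rfl ht
  rw [fiber_eq]
  -- (L3) on the cell, the blue cluster of `x` uses no edge at `S₀`: `K(tᶜ) = K(tᶜ ∖ B)`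
  have blue_off : ∀ t : Finset ι, t ∩ B = π → K tᶜ = K (tᶜ \ B) := by
    intro t ht
    have agree : ∀ i, i ∈ B → (i ∈ t ↔ i ∈ s₀) := by
      intro i hi
      have := congrArg (fun u : Finset ι => i ∈ u) ht
      simp only [hπ, Finset.mem_inter, hi, and_true, eq_iff_iff] at this
      exact this
    have hBt : Bl t = S₀ := locality s₀ t ht
    apply Set.Subset.antisymm
    · -- a blue walk from `x ∉ S₀` never meets `S₀`, hence uses no edge at `S₀`
      have htr : ∀ u ∈ S₀ᶜ, ∀ w, (openGraph (ends '' (↑(tᶜ) : Set ι))).Adj u w →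
          (openGraph (ends '' (↑(tᶜ \ B) : Set ι))).Adj u w ∧ w ∈ S₀ᶜ := by
        intro u hu w hadj
        have hadj0 := hadj
        rw [openGraph_image_adj] at hadj
        obtain ⟨⟨i, hit, hi⟩, hne⟩ := hadj
        -- `w ∉ S₀`: otherwise the blue edge `i` would put `u` into the blue cluster of `z`
        have hwS : w ∈ S₀ᶜ := by
          intro hwS
          have hwBt : w ∈ Bl t := by rw [hBt]; exact hwS
          have huBt : u ∈ Bl t := Bl_closed t hwBt (hadj0.symm)
          rw [hBt] at huBt
          exact hu huBt
        have hiB : i ∉ B := by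
          intro hiB
          have hiB' := hiB
          simp only [hB, hI, Finset.mem_filter, Finset.mem_univ, true_and] at hiB'
          obtain ⟨v, hvS, hvi⟩ := hiB'
          rw [hi, Sym2.mem_iff] at hvi
          rcases hvi with rfl | rfl
          · exact hu hvS
          · exact hwS hvS
        refine ⟨?_, hwS⟩
        rw [openGraph_image_adj]
        exact ⟨⟨i, Finset.mem_sdiff.mpr ⟨hit, hiB⟩, hi⟩, hne⟩
      intro y hy
      obtain ⟨p⟩ := hy
      exact ((reachable_transfer S₀ᶜ htr p) hxS₀).1
    · exact openCluster_image_mono ends Finset.sdiff_subset x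
  -- (L4) on the cell, `t = (t ∖ B) ∪ π` and `tᶜ ∖ B = Bᶜ ∖ (t ∖ B)`
  have red_eq : ∀ t : Finset ι, t ∩ B = π → t = (t \ B) ∪ π := by
    intro t ht
    rw [← ht]
    ext i
    simp only [Finset.mem_union, Finset.mem_sdiff, Finset.mem_inter]
    tauto
  have blue_eq : ∀ t : Finset ι, tᶜ \ B = Bᶜ \ (t \ B) := by
    intro t
    ext i
    simp only [Finset.mem_sdiff, Finset.mem_compl]
    tauto
  -- reindex the cell by `t ↦ t ∖ B ∈ (Bᶜ).powerset` and recognise the REACH sum of the gadget instance `(Bᶜ, π)`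
  have hcell_sum : ∑ t ∈ univ.filter (fun t : Finset ι => t ∩ B = π), (if z ∈ K t then Φ t else 0) =
      ∑ ω ∈ (Bᶜ).powerset, (if z ∈ K (ω ∪ π) then
        (f (K (ω ∪ π)) - f (K (Bᶜ \ ω))) * (g (K (ω ∪ π)) - g (K (Bᶜ \ ω))) else 0) := by
    refine Finset.sum_bij' (fun t _ => t \ B) (fun ω _ => ω ∪ π) ?_ ?_ ?_ ?_ ?_
    · intro t _
      exact Finset.mem_powerset.mpr (fun i hi => Finset.mem_compl.mpr (Finset.mem_sdiff.mp hi).2)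
    · intro ω hω
      have hωB : Disjoint ω B := by
        rw [Finset.disjoint_left]
        intro i hi hiB
        exact (Finset.mem_compl.mp (Finset.mem_powerset.mp hω hi)) hiB
      simp only [Finset.mem_filter, Finset.mem_univ, true_and]
      rw [Finset.union_inter_distrib_right, Finset.disjoint_iff_inter_eq_empty.mp hωB, Finset.empty_union]
      exact Finset.inter_eq_left.mpr hπB
    · intro t ht
      have ht' : t ∩ B = π := (Finset.mem_filter.mp ht).2
      exact (red_eq t ht').symm
    · intro ω hω
      have hωB : Disjoint ω B := by
        rw [Finset.disjoint_left]
        intro i hi hiB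
        exact (Finset.mem_compl.mp (Finset.mem_powerset.mp hω hi)) hiB
      rw [Finset.union_sdiff_distrib, Finset.sdiff_eq_self_of_disjoint hωB,
        Finset.sdiff_eq_empty_iff_subset.mpr hπB, Finset.union_empty]
    · intro t ht
      have ht' : t ∩ B = π := (Finset.mem_filter.mp ht).2
      have h1 : K t = K ((t \ B) ∪ π) := by rw [← red_eq t ht']
      have h2 : K tᶜ = K (Bᶜ \ (t \ B)) := by rw [blue_off t ht', blue_eq t]
      simp only [hΦ]
      rw [← h1, ← h2]
  rw [hcell_sum]
  have hdisj : Disjoint Bᶜ π := by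
    rw [Finset.disjoint_left]
    intro i hi hiπ
    exact (Finset.mem_compl.mp hi) (hπB hiπ)
  have hfree : ∀ i ∈ Bᶜ, z ∉ ends i := by
    intro i hi hzi
    exact (Finset.mem_compl.mp hi) (mem_I S₀ i z (z_mem_Bl s₀) hzi)
  exact hreach Bᶜ π hdisj hfree

omit [Fintype ι] in
open Classical in
/-- **TRANSFER (gadget leaf) — and the STATUS OF THE REACH ROUTE (correction, prim-lf-2 gen 40, thirty minutes after the two theorems above
landed).**  If `e` has ends `{z, y}`, no edge of `B` meets `z` and `z ≠ x`, then `z ∈ C_x(insert e B) ↔ y ∈ C_x(B)`.  Consequence: the gadget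
instance `(E, insert e Γ)` with `z` free-isolated — an instance ALLOWED by the sharp hypothesis of `decided_twoColouring_nonneg_of_reach_isolated`
— has REACH sum equal (for point functions avoiding `z`) to the PLAIN REACH sum `Σ_{ω ⊆ E} 1{y ∈ C_x(ω ∪ Γ)} σ_u σ_w` of `y`, and that is NEGATIVE
already for `Γ = ∅` on the 7-vertex two-lobe graph W7 = {x1, x2, x3, x4, x5, 23, 34, 46, 15, 56} (`y = 6, u = 2, w = 1`: status sums
`(c_N, c_R, c_B, c_D) = (0, 11, 11, −12)`, REACH `= −1`; exhaustively 720 of the 111 975 360 labelled instances at `n = 7` are negative, kit j159840).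
Adding the pendant leaf `7` at `6` gives W8, on which the CONCLUSION fails too: `Σ_{s : 7 ∈ C(s), 7 ∉ C(sᶜ)} σ_2 σ_1 = −1`, i.e.
`T''(7)[1_2, 1_1] < 0` — the conjecture `T'' ≥ 0` of CW-PROGRAMME-gen21 is FALSE (memo `prim-lf-2/CW-GINIBRE-gen40.md` §2, evidence file
`TPP-REFUTATION-gen40.md` on stmt-4575).  So both reduction theorems of this line are correct but their hypotheses are refuted as principles and
their conclusion is not a valid conjecture: the REACH / decided route to the point row is CLOSED; only the wall classes (CW-PA) survive.
[cite: KozmaNitzan2024, Questions 8–9 (§5.5 p. 36) (context)] -/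
theorem mem_openCluster_insert_gadgetLeaf_iff (ends : ι → Sym2 V) {B : Finset ι} {e : ι} {x z y : V} (he : ends e = s(z, y))
    (hz : ∀ i ∈ B, z ∉ ends i) (hzx : z ≠ x) :
    z ∈ openCluster (ends '' (↑(insert e B) : Set ι)) x ↔ y ∈ openCluster (ends '' (↑B : Set ι)) x := by
  have hzB : z ∉ openCluster (ends '' (↑B : Set ι)) x := not_mem_openCluster_of_forall_not_mem ends hz hzx
  have h := not_mem_openCluster_insert_zEdge_iff ends (B := B) (x := x) he
  constructor
  · intro hzI
    by_contra hy
    exact (h.mpr ⟨hzB, hy⟩) hzI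
  · intro hy
    by_contra hzI
    exact (h.mp hzI).2 hy

end Coefficientwise

end Summit.CriticalPhenomena.PercolationContinuityZ3.Theorems
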